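import Mathlib
import Summits.ResolutionOfSingularities.ResolutionOfSingularities.Theorems.WildQuotientsWildQuotientResolutionFixedPointsGraded
import Summits.ResolutionOfSingularities.ResolutionOfSingularities.Theorems.WildQuotientsWildQuotientResolutionToricExitTranslationFixed
import Literature.AlgebraicGeometry.Resolution.ResolutionOfComponents

/-!
# The ℤ9 specimen, brick Z0: the peel `k[x]^⟨J₄⟩ ≃ k[x]^⟨σ̄⟩` (char 3)

(crux stmt-ResolutionOfSingularities-15640 `WildQuotients.WildQuotientResolution`, S1 = stmt-…-17941
`CyclicQuotientFourfolds`, non-linear sector; ℤ9 SPECIMEN of res-L1-w45c-idea-2's card P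
(`cardP_g12/Z9-SPECIMEN.md` §0, brick Z0), res-L1-w45c-plan-1 GO 2026-08-27T16:29:20Z / letters
16:29:52Z; [OURS · L1 W4.5c] — NOT a statement of any manuscript; replaces the role of no printed item.
Prover res-L1-w45c-stub-1.)

Upstairs `σ = J₄` on `k[x]` (`σ x_a = x_a, σ x_b = x_b + x_a, σ x_c = x_c + x_b, σ x_d = x_d + x_c`,
passengers fixed; order 9 in characteristic 3). Its cube is the TRANSVECTION `x_d ↦ x_d + x_a`
(`pow_three_apply_X_*`), whose invariants are the polynomial ring `k[xᵢ (i ≠ d), w]`,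
`w = x_d³ − x_a² x_d` (Artin–Schreier; B1 `ToricExit.mem_adjoin_of_translate_eq`). The comparison map
`φ : x_d ↦ w, xᵢ ↦ xᵢ` is injective (`aeval_peel_injective`, via `k[x] ≅ A[X]` and
`Polynomial.comp_eq_zero_iff`) and intertwines the DESCENDED automorphism
`σ̄ : x_b ↦ x_b + x_a, x_c ↦ x_c + x_b, x_d ↦ x_d + x_c³ − x_a²x_c` with `σ`
(`σ ∘ φ = φ ∘ σ̄`, because `(x_d + x_c)³ = x_d³ + x_c³` in characteristic 3). Hence:

* `exists_descended` — `σ̄` exists as a `k`-algebra automorphism with these values (explicit inverse);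
* `peel_equiv` — `k[x]^⟨σ⟩ ≃ₐ[k] k[x]^⟨σ̄⟩` (the O12a mould `DihedralPerm.dihedralPermInvariantsEquiv`);
* `hasResolution_of_peeled` — `HasResolution (Spec k[x]^⟨σ̄⟩) → HasResolution (Spec k[x]^⟨σ⟩)`:
  the ℤ9 corollary of the peeled target `z9Peeled_hasResolution_charThree` is a one-liner.
-/

-- single-problem summit: the doubled namespace component `ResolutionOfSingularities` is forced
set_option linter.dupNamespace false

noncomputable section

open MvPolynomial AlgebraicGeometry CategoryTheory Literature.AlgebraicGeometry.Resolution

namespace Summit.ResolutionOfSingularities.ResolutionOfSingularities.Theorems.WildQuotientResolution.Z9Peeled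

variable (k : Type) [Field k] (n : ℕ) (a b c d : Fin n)
  (hab : a ≠ b) (hac : a ≠ c) (had : a ≠ d) (hbc : b ≠ c) (hbd : b ≠ d) (hcd : c ≠ d)

include hab hac had hbc hbd hcd in
/-- **The descended automorphism exists**: there is `σ̄ : k[x] ≃ₐ[k] k[x]` with `σ̄ x_a = x_a`,
`σ̄ x_b = x_b + x_a`, `σ̄ x_c = x_c + x_b`, `σ̄ x_d = x_d + x_c³ − x_a² x_c`, `σ̄ xᵢ = xᵢ` otherwise
(explicit inverse `x_b ↦ x_b − x_a`, `x_c ↦ x_c − x_b + x_a`,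
`x_d ↦ x_d − ((x_c − x_b + x_a)³ − x_a²(x_c − x_b + x_a))`; any characteristic). [OURS · L1 W4.5c] -/
theorem exists_descended :
    ∃ τ : MvPolynomial (Fin n) k ≃ₐ[k] MvPolynomial (Fin n) k,
      τ (X a) = X a ∧ τ (X b) = X b + X a ∧ τ (X c) = X c + X b ∧
        τ (X d) = X d + X c ^ 3 - X a ^ 2 * X c ∧ ∀ i, i ≠ b → i ≠ c → i ≠ d → τ (X i) = X i := by
  classical
  let φ : MvPolynomial (Fin n) k →ₐ[k] MvPolynomial (Fin n) k :=
    aeval fun i => if i = b then X b + X a else if i = c then X c + X b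
      else if i = d then X d + X c ^ 3 - X a ^ 2 * X c else X i
  let φ' : MvPolynomial (Fin n) k →ₐ[k] MvPolynomial (Fin n) k :=
    aeval fun i => if i = b then X b - X a else if i = c then X c - X b + X a
      else if i = d then X d - ((X c - X b + X a) ^ 3 - X a ^ 2 * (X c - X b + X a)) else X i
  have hφb : φ (X b) = X b + X a := by simp [φ]
  have hφc : φ (X c) = X c + X b := by simp [φ, Ne.symm hbc]
  have hφd : φ (X d) = X d + X c ^ 3 - X a ^ 2 * X c := by simp [φ, Ne.symm hbd, Ne.symm hcd]
  have hφi : ∀ i, i ≠ b → i ≠ c → i ≠ d → φ (X i) = X i := by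
    intro i hib hic hid; simp [φ, hib, hic, hid]
  have hφ'b : φ' (X b) = X b - X a := by simp [φ']
  have hφ'c : φ' (X c) = X c - X b + X a := by simp [φ', Ne.symm hbc]
  have hφ'd : φ' (X d) = X d - ((X c - X b + X a) ^ 3 - X a ^ 2 * (X c - X b + X a)) := by
    simp [φ', Ne.symm hbd, Ne.symm hcd]
  have hφ'i : ∀ i, i ≠ b → i ≠ c → i ≠ d → φ' (X i) = X i := by
    intro i hib hic hid; simp [φ', hib, hic, hid]
  have hφa : φ (X a) = X a := hφi a hab hac had
  have hφ'a : φ' (X a) = X a := hφ'i a hab hac had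
  have h1 : φ.comp φ' = AlgHom.id k _ := by
    refine MvPolynomial.algHom_ext fun i => ?_
    change φ (φ' (X i)) = X i
    by_cases hib : i = b
    · rw [hib, hφ'b, map_sub, hφb, hφa]; ring
    by_cases hic : i = c
    · rw [hic, hφ'c, map_add, map_sub, hφc, hφb, hφa]; ring
    by_cases hid : i = d
    · rw [hid, hφ'd]
      simp only [map_sub, map_add, map_pow, map_mul, hφd, hφc, hφb, hφa]
      ring
    · rw [hφ'i i hib hic hid, hφi i hib hic hid]
  have h2 : φ'.comp φ = AlgHom.id k _ := by
    refine MvPolynomial.algHom_ext fun i => ?_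
    change φ' (φ (X i)) = X i
    by_cases hib : i = b
    · rw [hib, hφb, map_add, hφ'b, hφ'a]; ring
    by_cases hic : i = c
    · rw [hic, hφc, map_add, hφ'c, hφ'b]; ring
    by_cases hid : i = d
    · rw [hid, hφd]
      simp only [map_sub, map_add, map_pow, map_mul, hφ'd, hφ'c, hφ'a]
      ring
    · rw [hφi i hib hic hid, hφ'i i hib hic hid]
  exact ⟨AlgEquiv.ofAlgHom φ φ' h1 h2, hφa, hφb, hφc, hφd, hφi⟩

variable (σ τ : MvPolynomial (Fin n) k ≃ₐ[k] MvPolynomial (Fin n) k)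
  (hσa : σ (X a) = X a) (hσb : σ (X b) = X b + X a) (hσc : σ (X c) = X c + X b)
  (hσd : σ (X d) = X d + X c) (hσ : ∀ i, i ≠ b → i ≠ c → i ≠ d → σ (X i) = X i)
  (hτa : τ (X a) = X a) (hτb : τ (X b) = X b + X a) (hτc : τ (X c) = X c + X b)
  (hτd : τ (X d) = X d + X c ^ 3 - X a ^ 2 * X c) (hτ : ∀ i, i ≠ b → i ≠ c → i ≠ d → τ (X i) = X i)

/-! ### The cube of `J₄` in characteristic 3 is the transvection `x_d ↦ x_d + x_a` -/

section Cube

include hσb hσ hab hac had in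
/-- `σ³ x_b = x_b` (`= x_b + 3 x_a`). [OURS · L1 W4.5c] -/
theorem pow_three_apply_X_b [CharP k 3] : σ (σ (σ (X b))) = X b := by
  have hσa' : σ (X a) = X a := hσ a hab hac had
  have h3 : (3 : MvPolynomial (Fin n) k) = 0 := CharP.cast_eq_zero _ 3
  have h : σ (σ (σ (X b))) = X b + 3 * X a := by
    simp only [hσb, hσa', map_add]; ring
  rw [h, h3, zero_mul, add_zero]

include hσb hσc hσ hab hac had in
/-- `σ³ x_c = x_c` (`= x_c + 3 x_b + 3 x_a`). [OURS · L1 W4.5c] -/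
theorem pow_three_apply_X_c [CharP k 3] : σ (σ (σ (X c))) = X c := by
  have hσa' : σ (X a) = X a := hσ a hab hac had
  have h3 : (3 : MvPolynomial (Fin n) k) = 0 := CharP.cast_eq_zero _ 3
  have h : σ (σ (σ (X c))) = X c + 3 * X b + 3 * X a := by
    simp only [hσc, hσb, hσa', map_add]; ring
  rw [h, h3, zero_mul, zero_mul, add_zero, add_zero]

include hσb hσc hσd in
/-- `σ³ x_d = x_d + x_a` (`= x_d + 3 x_c + 3 x_b + x_a`): the TRANSVECTION. [OURS · L1 W4.5c] -/
theorem pow_three_apply_X_d [CharP k 3] : σ (σ (σ (X d))) = X d + X a := by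
  have h3 : (3 : MvPolynomial (Fin n) k) = 0 := CharP.cast_eq_zero _ 3
  have h : σ (σ (σ (X d))) = X d + X a + 3 * X c + 3 * X b := by
    simp only [hσd, hσc, hσb, map_add]; ring
  rw [h, h3, zero_mul, zero_mul, add_zero, add_zero]

include hσb hσc hσd hσ hab hac had in
/-- `σ³` is the translation `x_d ↦ x_d + x_a` (as the `aeval` of `ToricExit.mem_adjoin_of_translate_eq`).
[OURS · L1 W4.5c] -/
theorem aeval_translate_eq_pow_three [CharP k 3] (f : MvPolynomial (Fin n) k) :
    aeval (fun i : Fin n => if i = d then X d + X a else (X i : MvPolynomial (Fin n) k)) f =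
      σ (σ (σ f)) := by
  classical
  induction f using MvPolynomial.induction_on with
  | C r =>
    rw [← MvPolynomial.algebraMap_eq, AlgHom.commutes, AlgEquiv.commutes, AlgEquiv.commutes,
      AlgEquiv.commutes]
  | add p q hp hq => rw [map_add, map_add, map_add, map_add, hp, hq]
  | mul_X p i hp =>
    rw [map_mul, map_mul, map_mul, map_mul, hp, aeval_X]
    congr 1
    by_cases hid : i = d
    · rw [if_pos hid, hid, pow_three_apply_X_d k n a b c d σ hσb hσc hσd]
    · rw [if_neg hid]
      by_cases hib : i = b
      · rw [hib, pow_three_apply_X_b k n a b c d hab hac had σ hσb hσ]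
      by_cases hic : i = c
      · rw [hic, pow_three_apply_X_c k n a b c d hab hac had σ hσb hσc hσ]
      · rw [hσ i hib hic hid, hσ i hib hic hid, hσ i hib hic hid]

end Cube

/-! ### The comparison map `φ : x_d ↦ w = x_d³ − x_a² x_d` -/

section PeelMap

include had in
/-- **The comparison map `x_d ↦ x_d³ − x_a²x_d` (other variables fixed) is injective**: through
`k[x] ≅ A[X]` (`A = k[xᵢ : i ≠ d]`) it is the composition with the non-constant polynomial
`X³ − x_a² X` over the domain `A`. [folklore] -/
theorem aeval_peel_injective :
    Function.Injective (aeval (fun i : Fin n => if i = d then X d ^ 3 - X a ^ 2 * X d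
      else (X i : MvPolynomial (Fin n) k)) : MvPolynomial (Fin n) k →ₐ[k] MvPolynomial (Fin n) k) := by
  classical
  set φ : MvPolynomial (Fin n) k →ₐ[k] MvPolynomial (Fin n) k :=
    aeval (fun i : Fin n => if i = d then X d ^ 3 - X a ^ 2 * X d else (X i : MvPolynomial (Fin n) k))
    with hφ
  have hφd : φ (X d) = X d ^ 3 - X a ^ 2 * X d := by rw [hφ, aeval_X, if_pos rfl]
  have hφi : ∀ i, i ≠ d → φ (X i) = X i := fun i hi => by rw [hφ, aeval_X, if_neg hi]
  let A := MvPolynomial {i : Fin n // i ≠ d} k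
  let Φ : MvPolynomial (Fin n) k ≃ₐ[k] Polynomial A :=
    (renameEquiv k (Equiv.optionSubtypeNe d).symm).trans (optionEquivLeft k {i : Fin n // i ≠ d})
  let q : Polynomial A := Polynomial.X ^ 3 - Polynomial.C ((X ⟨a, had⟩ : A) ^ 2) * Polynomial.X
  have hΦd : Φ (X d) = Polynomial.X := ToricExit.splitEquiv_X_self k n d
  have hΦi : ∀ i (hi : i ≠ d), Φ (X i) = Polynomial.C (X ⟨i, hi⟩) :=
    fun i hi => ToricExit.splitEquiv_X_of_ne k n d i hi
  -- `Φ ∘ φ = (aeval q) ∘ Φ`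
  have hcomp : (Φ : MvPolynomial (Fin n) k →ₐ[k] Polynomial A).comp φ =
      ((Polynomial.aeval q).restrictScalars k).comp (Φ : MvPolynomial (Fin n) k →ₐ[k] Polynomial A) := by
    refine MvPolynomial.algHom_ext fun i => ?_
    simp only [AlgHom.comp_apply, AlgHom.restrictScalars_apply, AlgEquiv.coe_toAlgHom]
    by_cases hid : i = d
    · subst hid
      rw [hφd, map_sub, map_mul, map_pow, map_pow, hΦd, hΦi a had, Polynomial.aeval_X]
      simp only [q, map_pow]
    · rw [hφi i hid, hΦi i hid, Polynomial.aeval_C, Polynomial.algebraMap_eq]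
  have hfun : ∀ f, Φ (φ f) = Polynomial.aeval q (Φ f) := fun f => by
    simpa using congrArg (fun g => g f) hcomp
  -- `aeval q = (· .comp q)` is injective since `q` is not constant
  have hq3 : q.coeff 3 = 1 := by
    change (Polynomial.X ^ 3 - Polynomial.C ((X ⟨a, had⟩ : A) ^ 2) * Polynomial.X).coeff 3 = 1
    rw [Polynomial.coeff_sub, Polynomial.coeff_X_pow, if_pos rfl, Polynomial.coeff_C_mul,
      Polynomial.coeff_X, if_neg (by norm_num), mul_zero, sub_zero]
  have hqC : q ≠ Polynomial.C (q.coeff 0) := by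
    intro h
    have h3 := congrArg (fun r => Polynomial.coeff r 3) h
    rw [hq3, Polynomial.coeff_C, if_neg (by norm_num)] at h3
    exact one_ne_zero h3
  intro f g hfg
  have h := congrArg Φ hfg
  rw [hfun, hfun, ← Polynomial.comp_eq_aeval, ← Polynomial.comp_eq_aeval] at h
  have h0 : (Φ f - Φ g).comp q = 0 := by rw [Polynomial.sub_comp, h, sub_self]
  rcases Polynomial.comp_eq_zero_iff.mp h0 with h1 | ⟨_, h2⟩
  · exact Φ.injective (sub_eq_zero.mp h1)
  · exact absurd h2 hqC

/-- The range of the comparison map is `k[w, xᵢ (i ≠ d)]`, `w = x_d³ − x_a² x_d`. [folklore] -/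
theorem range_aeval_peel :
    (aeval (fun i : Fin n => if i = d then X d ^ 3 - X a ^ 2 * X d
      else (X i : MvPolynomial (Fin n) k)) : MvPolynomial (Fin n) k →ₐ[k] MvPolynomial (Fin n) k).range =
      Algebra.adjoin k (({X d ^ 3 - X a ^ (3 - 1) * X d} : Set (MvPolynomial (Fin n) k)) ∪
        ((fun i => X i) '' {i | i ≠ d})) := by
  classical
  rw [← Algebra.adjoin_range_eq_range_aeval]
  congr 1
  ext x
  simp only [Set.mem_range, Set.mem_union, Set.mem_singleton_iff, Set.mem_image, Set.mem_setOf_eq]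
  constructor
  · rintro ⟨i, rfl⟩
    by_cases hid : i = d
    · left; rw [if_pos hid]
    · right; exact ⟨i, hid, by rw [if_neg hid]⟩
  · rintro (rfl | ⟨i, hid, rfl⟩)
    · exact ⟨d, by rw [if_pos rfl]⟩
    · exact ⟨i, by rw [if_neg hid]⟩

end PeelMap

/-! ### The peel -/

include hab hac had hbd hcd hσa hσb hσc hσd hσ hτb hτc hτd hτ in
/-- **Z0, the peel** [OURS · L1 W4.5c]: for `σ = J₄` on `k[x]` (char 3) and the descended `σ̄ = τ`
(`τ x_b = x_b + x_a`, `τ x_c = x_c + x_b`, `τ x_d = x_d + x_c³ − x_a²x_c`, passengers fixed), the invariant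
rings are isomorphic as `k`-algebras: `k[x]^⟨σ⟩ ≃ₐ[k] k[x]^⟨τ⟩`. The isomorphism is induced by
`φ : x_d ↦ w = x_d³ − x_a²x_d`, `xᵢ ↦ xᵢ`: `σ ∘ φ = φ ∘ τ` (`(x_d + x_c)³ = x_d³ + x_c³`), `φ` is injective
(`aeval_peel_injective`) with range `k[w, xᵢ (i ≠ d)] = k[x]^{σ³}` (`σ³ = x_d ↦ x_d + x_a`, B1
`ToricExit.mem_adjoin_of_translate_eq`), so `φ` restricts to a bijection `k[x]^⟨τ⟩ → k[x]^⟨σ⟩`. -/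
theorem peel_equiv [CharP k 3] :
    Nonempty (↥(FixedPoints.subalgebra k (MvPolynomial (Fin n) k) (Subgroup.zpowers σ)) ≃ₐ[k]
      ↥(FixedPoints.subalgebra k (MvPolynomial (Fin n) k) (Subgroup.zpowers τ))) := by
  classical
  haveI : Fact (Nat.Prime 3) := ⟨Nat.prime_three⟩
  -- the comparison map
  let φ : MvPolynomial (Fin n) k →ₐ[k] MvPolynomial (Fin n) k :=
    aeval fun i => if i = d then X d ^ 3 - X a ^ 2 * X d else X i
  have hφd : φ (X d) = X d ^ 3 - X a ^ 2 * X d := by simp [φ]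
  have hφi : ∀ i, i ≠ d → φ (X i) = X i := by intro i hid; simp [φ, hid]
  have hφa : φ (X a) = X a := hφi a had
  have hφb : φ (X b) = X b := hφi b hbd
  have hφc : φ (X c) = X c := hφi c hcd
  -- intertwining `σ ∘ φ = φ ∘ τ`
  have hcube : (X d + X c : MvPolynomial (Fin n) k) ^ 3 = X d ^ 3 + X c ^ 3 :=
    add_pow_char (X d) (X c) 3
  have hστ : ∀ x, σ (φ x) = φ (τ x) := by
    intro x
    have h := MvPolynomial.algHom_ext
      (f := ((σ : MvPolynomial (Fin n) k →ₐ[k] MvPolynomial (Fin n) k).comp φ))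
      (g := (φ.comp (τ : MvPolynomial (Fin n) k →ₐ[k] MvPolynomial (Fin n) k))) (fun i => by
        simp only [AlgHom.comp_apply, AlgEquiv.coe_toAlgHom]
        by_cases hid : i = d
        · rw [hid, hφd, hτd, map_sub, map_mul, map_pow, map_pow, hσd, hσa, map_sub, map_add,
            map_mul, map_pow, map_pow, hφd, hφc, hφa, hcube]
          ring
        by_cases hib : i = b
        · rw [hib, hφb, hσb, hτb, map_add, hφb, hφa]
        by_cases hic : i = c
        · rw [hic, hφc, hσc, hτc, map_add, hφc, hφb]
        · rw [hφi i hid, hσ i hib hic hid, hτ i hib hic hid, hφi i hid])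
    simpa [AlgHom.comp_apply] using congrArg (fun g => g x) h
  have hinj : Function.Injective φ := aeval_peel_injective k n a d had
  -- `σ`-invariants lie in the range of `φ` (B1 applied to the transvection `σ³`)
  have hrange : ∀ g : MvPolynomial (Fin n) k, σ g = g → g ∈ φ.range := by
    intro g hg
    have hfix : aeval (fun i : Fin n => if i = d then X d + X a
        else (X i : MvPolynomial (Fin n) k)) g = g := by
      rw [aeval_translate_eq_pow_three k n a b c d hab hac had σ hσb hσc hσd hσ g, hg, hg, hg]
    have hmem := ToricExit.mem_adjoin_of_translate_eq k n a d had 3 Nat.prime_three g hfix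
    change g ∈ (aeval _).range
    rw [range_aeval_peel k n a d]
    exact hmem
  -- the restriction of `φ` to `τ`-invariants, with values in `σ`-invariants
  let Fσ := FixedPoints.subalgebra k (MvPolynomial (Fin n) k) (Subgroup.zpowers σ)
  let Fτ := FixedPoints.subalgebra k (MvPolynomial (Fin n) k) (Subgroup.zpowers τ)
  have hmem : ∀ f : Fτ, φ (f : MvPolynomial (Fin n) k) ∈ Fσ := by
    intro f
    have hf : τ (f : MvPolynomial (Fin n) k) = f :=
      (TameTransfer.mem_fixedPoints_zpowers_iff_apply_eq τ _).mp f.2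
    rw [TameTransfer.mem_fixedPoints_zpowers_iff_apply_eq, hστ, hf]
  let ψ : Fτ →ₐ[k] Fσ := (φ.comp Fτ.val).codRestrict Fσ hmem
  have hψinj : Function.Injective ψ := by
    intro f g hfg
    have h : φ (f : MvPolynomial (Fin n) k) = φ g := congrArg Subtype.val hfg
    exact Subtype.ext (hinj h)
  have hψsurj : Function.Surjective ψ := by
    intro g
    have hg : σ (g : MvPolynomial (Fin n) k) = g :=
      (TameTransfer.mem_fixedPoints_zpowers_iff_apply_eq σ _).mp g.2
    obtain ⟨f, hf⟩ := hrange g hg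
    have hf' : φ f = g := hf
    have hfτ : f ∈ Fτ := by
      rw [TameTransfer.mem_fixedPoints_zpowers_iff_apply_eq]
      apply hinj
      rw [← hστ, hf', hg]
    exact ⟨⟨f, hfτ⟩, Subtype.ext hf'⟩
  exact ⟨(AlgEquiv.ofBijective ψ ⟨hψinj, hψsurj⟩).symm⟩

include hab hac had hbd hcd hσa hσb hσc hσd hσ hτb hτc hτd hτ in
/-- **Transfer along the peel**: a resolution of `Spec k[x]^⟨σ̄⟩` (the peeled ℤ9 specimen) gives a
resolution of `Spec k[x]^⟨J₄⟩ = 𝔸ⁿ/ℤ9` (char 3). [OURS · L1 W4.5c] -/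
theorem hasResolution_of_peeled [CharP k 3]
    (h : Scheme.HasResolution
      (Spec (.of (FixedPoints.subalgebra k (MvPolynomial (Fin n) k) (Subgroup.zpowers τ))))) :
    Scheme.HasResolution
      (Spec (.of (FixedPoints.subalgebra k (MvPolynomial (Fin n) k) (Subgroup.zpowers σ)))) := by
  obtain ⟨e⟩ := peel_equiv k n a b c d hab hac had hbd hcd σ τ hσa hσb hσc hσd hσ hτb hτc hτd hτ
  let ι : CommRingCat.of ↥(FixedPoints.subalgebra k (MvPolynomial (Fin n) k) (Subgroup.zpowers σ)) ≅
      CommRingCat.of ↥(FixedPoints.subalgebra k (MvPolynomial (Fin n) k) (Subgroup.zpowers τ)) :=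
    e.toRingEquiv.toCommRingCatIso
  exact Scheme.HasResolution.of_iso (Spec.map ι.hom) h

end Summit.ResolutionOfSingularities.ResolutionOfSingularities.Theorems.WildQuotientResolution.Z9Peeled

end
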